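import Mathlib.Data.Finite.Prod
import Mathlib.Data.Finite.Sigma
import Mathlib.Data.Finite.Sum
import Literature.AnabelianGeometry.SemiGraphs.EmbeddingCriterion
import Literature.AnabelianGeometry.SemiGraphs.BouquetCriteria

/-!
# Proof of [SemiAnbd] Lemma 1.5: an immersion `G → H_n` extends to a finite graph-covering

Mochizuki, *Semi-graphs of anabelioids*, Publ. RIMS **42** (2006) 221–322, §1, Lemma 1.5, author's
manuscript pp. 17–18 [cite: MochizukiSemiAnbd2006, Lem. 1.5 p.17]: "Let `φ : G → H_n` be an
immersion of finite graphs.  Then `φ` extends to a finite graph-covering `φ' : G' → H_n` for some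
embedding `G ↪ G'`.  Proof.  We construct `(G', φ')` from `(G, φ)` by adding edges (equipped with
orientations and colors) to `G` until the resulting `φ'` is excisive, i.e., satisfies the condition of
Lemma 1.3, (iii)."

This file DISCHARGES the named fact `SemiGraph.lemma_1_5` of `ZariskiMainTheorem.lean` (statement by
abc-iut-L3-t1).  The printed proof completes the partial injections "follow the `i`-coloured edge" one
missing branch at a time; we add the missing edges all at once by the standard doubling device, which
needs no counting and no choices: `G'` has the vertices `v` of `G` and a second copy `v̄` of each;
its edges are (1) the edges of `G`, (2) a reversed copy `ē : w̄ → v̄` of colour `i` for every edge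
`e : v → w` of colour `i` of `G`, (3) an edge `v → v̄` of colour `i` whenever no `i`-coloured edge
leaves `v`, and (4) an edge `v̄ → v` of colour `i` whenever no `i`-coloured edge enters `v`.  Since
`φ` is an immersion (at most one `i`-coloured edge enters / leaves each vertex), every vertex of `G'`
has exactly one entering and one leaving edge of each colour, so `φ' : G' → H_n` is an excision, hence
(Lemma 1.3 (iii), `lemma_1_3_iii'_holds` of `BouquetCriteria.lean`, abc-iut-L3-t1) a finite graph-covering; `G ↪ G'` is injective on vertices
and edges, hence an embedding (`isEmbedding_of_injective_of_isGraph`, file `EmbeddingCriterion.lean`).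
The whole construction lives inside the proof of `lemma_1_5_holds` (proof-only companion, no new
definitions; abc-iut cell, layer L3, DISCHARGE-C item C3).
-/

namespace Literature.AnabelianGeometry.SemiGraphs

namespace SemiGraph

open CategoryTheory

universe u

/-- `H_n` is a finite semi-graph. [cite: MochizukiSemiAnbd2006, §1 p.16] -/
theorem bouquet_isFinite (n : ℕ) : (bouquet.{u} n).IsFinite :=
  ⟨inferInstanceAs (Finite PUnit), inferInstanceAs (Finite (ULift (Fin n)))⟩

set_option maxHeartbeats 400000 in
/-- DISCHARGE of `lemma_1_5` ([SemiAnbd] Lemma 1.5): an immersion `φ : G → H_n` of finite graphs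
"extends to a finite graph-covering `φ' : G' → H_n` for some embedding `G ↪ G'`" — by the doubling
construction described in the module docstring. [cite: MochizukiSemiAnbd2006, Lem. 1.5 p.17] -/
theorem lemma_1_5_holds : lemma_1_5.{u} := by
  intro G n φ hG hGg hφ
  /- (0) Bookkeeping on `φ`: the colour component of the image of a branch is the colour of its edge. -/
  have hfst : ∀ b : G.Branch, (φ.branchMap b).down.1 = (φ.edgeMap (G.edgeOf b)).down :=
    fun b => congrArg ULift.down (φ.edgeOf_branchMap b)
  /- (1) The new semi-graph `G'`.  Index set of the new edges of direction `d`: pairs `(i, v)` such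
  that NO branch of colour `i` and direction `d` abuts to `v`. -/
  let Missing : Bool → Type u := fun d =>
    {p : ULift.{u} (Fin n) × G.Vertex //
      ∀ b : G.Branch, G.abuts b = some p.2 → (φ.branchMap b).down ≠ (p.1.down, d)}
  -- edges: old, reversed copies, new; branches: old, reversed copies, new × direction bit
  let CE : Type u := (G.Edge ⊕ G.Edge) ⊕ (Σ d : Bool, Missing d)
  let CB : Type u := (G.Branch ⊕ G.Branch) ⊕ ((Σ d : Bool, Missing d) × Bool)
  let cEdgeOf : CB → CE := fun
    | .inl (.inl b) => .inl (.inl (G.edgeOf b))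
    | .inl (.inr b) => .inl (.inr (G.edgeOf b))
    | .inr (m, _) => .inr m
  -- an old branch abuts to its old vertex, a reversed copy to `v̄`, the branch of direction `c` of
  -- the new edge `(d, (i, v))` to `v` if `c = d` and to `v̄` otherwise
  let cAbuts : CB → Option (G.Vertex ⊕ G.Vertex) := fun
    | .inl (.inl b) => (G.abuts b).map Sum.inl
    | .inl (.inr b) => (G.abuts b).map Sum.inr
    | .inr (⟨d, m⟩, c) => some (if c = d then Sum.inl m.1.2 else Sum.inr m.1.2)
  let G' : SemiGraph.{u} :=
    { Vertex := G.Vertex ⊕ G.Vertex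
      Edge := CE
      Branch := CB
      edgeOf := cEdgeOf
      abuts := cAbuts
      two_branches := by
        intro e
        rcases e with (e | e) | m
        · obtain ⟨b₁, b₂, hne, h₁, h₂, hall⟩ := G.two_branches e
          refine ⟨.inl (.inl b₁), .inl (.inl b₂), fun h => hne (Sum.inl.inj (Sum.inl.inj h)),
            congrArg (fun x => Sum.inl (Sum.inl x)) h₁, congrArg (fun x => Sum.inl (Sum.inl x)) h₂,
            fun b hb => ?_⟩
          rcases b with (b | b) | ⟨m', c⟩
          · rcases hall b (Sum.inl.inj (Sum.inl.inj hb)) with rfl | rfl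
            · exact Or.inl rfl
            · exact Or.inr rfl
          · cases Sum.inl.inj hb
          · cases hb
        · obtain ⟨b₁, b₂, hne, h₁, h₂, hall⟩ := G.two_branches e
          refine ⟨.inl (.inr b₁), .inl (.inr b₂), fun h => hne (Sum.inr.inj (Sum.inl.inj h)),
            congrArg (fun x => Sum.inl (Sum.inr x)) h₁, congrArg (fun x => Sum.inl (Sum.inr x)) h₂,
            fun b hb => ?_⟩
          rcases b with (b | b) | ⟨m', c⟩
          · cases Sum.inl.inj hb
          · rcases hall b (Sum.inr.inj (Sum.inl.inj hb)) with rfl | rfl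
            · exact Or.inl rfl
            · exact Or.inr rfl
          · cases hb
        · refine ⟨.inr (m, false), .inr (m, true), fun h => Bool.false_ne_true
            (congrArg Prod.snd (Sum.inr.inj h)), rfl, rfl, fun b hb => ?_⟩
          rcases b with (b | b) | ⟨m', c⟩
          · cases hb
          · cases hb
          · cases Sum.inr.inj hb
            cases c
            · exact Or.inl rfl
            · exact Or.inr rfl }
  -- how the three kinds of branches abut
  have abuts_old : ∀ {b : G.Branch} {w : G.Vertex ⊕ G.Vertex},
      G'.abuts (.inl (.inl b)) = some w ↔ ∃ v, G.abuts b = some v ∧ w = Sum.inl v := by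
    intro b w
    change (G.abuts b).map Sum.inl = some w ↔ _
    cases G.abuts b <;> simp [eq_comm]
  have abuts_rev : ∀ {b : G.Branch} {w : G.Vertex ⊕ G.Vertex},
      G'.abuts (.inl (.inr b)) = some w ↔ ∃ v, G.abuts b = some v ∧ w = Sum.inr v := by
    intro b w
    change (G.abuts b).map Sum.inr = some w ↔ _
    cases G.abuts b <;> simp [eq_comm]
  have abuts_new : ∀ {d : Bool} {m : Missing d} {c : Bool} {w : G.Vertex ⊕ G.Vertex},
      G'.abuts (.inr (⟨d, m⟩, c)) = some w ↔ w = if c = d then Sum.inl m.1.2 else Sum.inr m.1.2 := by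
    intro d m c w
    change some _ = some w ↔ _
    simp [eq_comm]
  /- (2) The extension `φ' : G' → H_n`: old branches keep colour and direction, reversed copies flip
  the direction, new branches carry their tags. -/
  let cColour : CE → ULift.{u} (Fin n) := fun
    | .inl (.inl e) => φ.edgeMap e
    | .inl (.inr e) => φ.edgeMap e
    | .inr m => m.2.1.1
  let cDir : CB → ULift.{u} (Fin n × Bool) := fun
    | .inl (.inl b) => φ.branchMap b
    | .inl (.inr b) => ⟨((φ.branchMap b).down.1, !(φ.branchMap b).down.2)⟩
    | .inr (m, c) => ⟨(m.2.1.1.down, c)⟩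
  let φ' : G' ⟶ bouquet.{u} n :=
    { vertexMap := fun _ => PUnit.unit
      edgeMap := cColour
      branchMap := cDir
      edgeOf_branchMap := by
        intro b
        rcases b with (b | b) | ⟨m, c⟩
        · exact φ.edgeOf_branchMap b
        · exact congrArg ULift.up (hfst b)
        · rfl
      branchMap_injOn := by
        intro b₁ b₂ he h
        rcases b₁ with (b₁ | b₁) | ⟨m₁, c₁⟩ <;> rcases b₂ with (b₂ | b₂) | ⟨m₂, c₂⟩
        · exact congrArg (fun x => Sum.inl (Sum.inl x))
            (φ.branchMap_injOn b₁ b₂ (Sum.inl.inj (Sum.inl.inj he)) h)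
        · cases Sum.inl.inj he
        · cases he
        · cases Sum.inl.inj he
        · have h' := congrArg ULift.down h
          simp only [cDir, Prod.mk.injEq, Bool.not_inj_iff] at h'
          have h1 : (φ.branchMap b₁).down.1 = (φ.branchMap b₂).down.1 := by
            rw [hfst, hfst, Sum.inr.inj (Sum.inl.inj he)]
          exact congrArg (fun x => Sum.inl (Sum.inr x)) (φ.branchMap_injOn b₁ b₂
            (Sum.inr.inj (Sum.inl.inj he)) (congrArg ULift.up (Prod.ext h1 h'.2)))
        · cases he
        · cases he
        · cases he
        · cases Sum.inr.inj he
          have h' := congrArg (fun x : ULift (Fin n × Bool) => x.down.2) h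
          exact congrArg (fun c => Sum.inr (m₁, c)) h'
      abuts_branchMap := fun _ _ _ => rfl }
  /- (3) The inclusion `ι : G → G'`, and `ι ≫ φ' = φ`. -/
  let ι : G ⟶ G' :=
    { vertexMap := Sum.inl
      edgeMap := fun e => Sum.inl (Sum.inl e)
      branchMap := fun b => Sum.inl (Sum.inl b)
      edgeOf_branchMap := fun _ => rfl
      branchMap_injOn := fun _ _ _ h => Sum.inl.inj (Sum.inl.inj h)
      abuts_branchMap := fun b v h => abuts_old.2 ⟨v, h, rfl⟩ }
  have hcomp : ι ≫ φ' = φ :=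
    SemiGraph.hom_ext _ _ (funext fun _ => rfl) (funext fun _ => rfl) (funext fun _ => rfl)
  /- (4) `G'` is a finite graph. -/
  have hfin : G'.IsFinite := by
    haveI := hG.finite_vertex
    haveI := hG.finite_edge
    haveI : ∀ d, Finite (Missing d) := fun d => Subtype.finite
    exact ⟨inferInstanceAs (Finite (G.Vertex ⊕ G.Vertex)),
      inferInstanceAs (Finite ((G.Edge ⊕ G.Edge) ⊕ (Σ d : Bool, Missing d)))⟩
  have hgraph : G'.IsGraph := by
    refine ⟨fun b => ?_⟩
    rcases b with (b | b) | ⟨m, c⟩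
    · change ((G.abuts b).map Sum.inl).isSome = true
      rw [Option.isSome_map]
      exact hGg.abuts_isSome b
    · change ((G.abuts b).map Sum.inr).isSome = true
      rw [Option.isSome_map]
      exact hGg.abuts_isSome b
    · rfl
  /- (5) `φ'` is an excision: every colour enters and leaves every vertex of `G'` exactly once. -/
  have hexc : IsExcision φ' := by
    intro w
    constructor
    · -- injectivity: two branches at `w` with the same colour and direction coincide
      rintro ⟨b₁, hb₁⟩ ⟨b₂, hb₂⟩ h
      have hd : cDir b₁ = cDir b₂ := congrArg Subtype.val h
      apply Subtype.ext
      change (b₁ : CB) = b₂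
      rcases b₁ with (b₁ | b₁) | ⟨⟨d₁, m₁⟩, c₁⟩ <;> rcases b₂ with (b₂ | b₂) | ⟨⟨d₂, m₂⟩, c₂⟩
      · obtain ⟨v, hv₁, rfl⟩ := abuts_old.1 hb₁
        obtain ⟨v', hv₂, hvv⟩ := abuts_old.1 hb₂
        cases Sum.inl.inj hvv
        have := hφ v (a₁ := ⟨b₁, hv₁⟩) (a₂ := ⟨b₂, hv₂⟩) (Subtype.ext hd)
        exact congrArg (fun x : G.Star v => (Sum.inl (Sum.inl x.1) : CB)) this
      · obtain ⟨v, -, rfl⟩ := abuts_old.1 hb₁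
        obtain ⟨v', -, hvv⟩ := abuts_rev.1 hb₂
        cases hvv
      · obtain ⟨v, hv₁, rfl⟩ := abuts_old.1 hb₁
        have hw := abuts_new.1 hb₂
        by_cases hcd : c₂ = d₂
        · rw [if_pos hcd] at hw
          cases Sum.inl.inj hw
          subst hcd
          exact absurd (congrArg ULift.down hd) (m₂.2 b₁ hv₁)
        · rw [if_neg hcd] at hw
          cases hw
      · obtain ⟨v, -, rfl⟩ := abuts_rev.1 hb₁
        obtain ⟨v', -, hvv⟩ := abuts_old.1 hb₂
        cases hvv
      · obtain ⟨v, hv₁, rfl⟩ := abuts_rev.1 hb₁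
        obtain ⟨v', hv₂, hvv⟩ := abuts_rev.1 hb₂
        cases Sum.inr.inj hvv
        have hd' := congrArg ULift.down hd
        simp only [cDir, Prod.mk.injEq, Bool.not_inj_iff] at hd'
        have := hφ v (a₁ := ⟨b₁, hv₁⟩) (a₂ := ⟨b₂, hv₂⟩)
          (Subtype.ext (congrArg ULift.up (Prod.ext hd'.1 hd'.2)))
        exact congrArg (fun x : G.Star v => (Sum.inl (Sum.inr x.1) : CB)) this
      · obtain ⟨v, hv₁, rfl⟩ := abuts_rev.1 hb₁
        have hw := abuts_new.1 hb₂
        by_cases hcd : c₂ = d₂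
        · rw [if_pos hcd] at hw
          cases hw
        · rw [if_neg hcd] at hw
          cases Sum.inr.inj hw
          have hd' := congrArg ULift.down hd
          simp only [cDir, Prod.mk.injEq] at hd'
          refine absurd ?_ (m₂.2 b₁ hv₁)
          rw [Prod.ext_iff]
          refine ⟨hd'.1, ?_⟩
          cases c₂ <;> cases d₂ <;> simp_all
      · obtain ⟨v, hv₂, rfl⟩ := abuts_old.1 hb₂
        have hw := abuts_new.1 hb₁
        by_cases hcd : c₁ = d₁
        · rw [if_pos hcd] at hw
          cases Sum.inl.inj hw
          subst hcd
          exact absurd (congrArg ULift.down hd).symm (m₁.2 b₂ hv₂)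
        · rw [if_neg hcd] at hw
          cases hw
      · obtain ⟨v, hv₂, rfl⟩ := abuts_rev.1 hb₂
        have hw := abuts_new.1 hb₁
        by_cases hcd : c₁ = d₁
        · rw [if_pos hcd] at hw
          cases hw
        · rw [if_neg hcd] at hw
          cases Sum.inr.inj hw
          have hd' := congrArg ULift.down hd
          simp only [cDir, Prod.mk.injEq] at hd'
          refine absurd ?_ (m₁.2 b₂ hv₂)
          rw [Prod.ext_iff]
          refine ⟨hd'.1.symm, ?_⟩
          cases c₁ <;> cases d₁ <;> simp_all
      · have hd' := congrArg ULift.down hd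
        simp only [cDir, Prod.mk.injEq] at hd'
        obtain ⟨hi, hc⟩ := hd'
        subst hc
        have hw₁ := abuts_new.1 hb₁
        have hw₂ := abuts_new.1 hb₂
        by_cases h₁ : c₁ = d₁ <;> by_cases h₂ : c₁ = d₂
        · rw [if_pos h₁] at hw₁
          rw [if_pos h₂] at hw₂
          subst h₁
          subst h₂
          have hv : m₁.1.2 = m₂.1.2 := Sum.inl.inj (hw₁.symm.trans hw₂)
          have hm : m₁ = m₂ := Subtype.ext (Prod.ext (ULift.ext _ _ hi) hv)
          subst hm
          rfl
        · rw [if_pos h₁] at hw₁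
          rw [if_neg h₂] at hw₂
          cases hw₁.symm.trans hw₂
        · rw [if_neg h₁] at hw₁
          rw [if_pos h₂] at hw₂
          cases hw₁.symm.trans hw₂
        · rw [if_neg h₁] at hw₁
          rw [if_neg h₂] at hw₂
          have hdd : d₁ = d₂ := by cases c₁ <;> cases d₁ <;> cases d₂ <;> simp_all
          subst hdd
          have hv : m₁.1.2 = m₂.1.2 := Sum.inr.inj (hw₁.symm.trans hw₂)
          have hm : m₁ = m₂ := Subtype.ext (Prod.ext (ULift.ext _ _ hi) hv)
          subst hm
          rfl
    · -- surjectivity: every colour and direction occurs at `w`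
      rintro ⟨⟨⟨i, c⟩⟩, -⟩
      rcases w with v | v
      · by_cases hex : ∃ b : G.Branch, G.abuts b = some v ∧ (φ.branchMap b).down = (i, c)
        · obtain ⟨b, hb, hbi⟩ := hex
          exact ⟨⟨.inl (.inl b), abuts_old.2 ⟨v, hb, rfl⟩⟩, Subtype.ext (ULift.ext _ _ hbi)⟩
        · have hm : ∀ b : G.Branch, G.abuts b = some v → (φ.branchMap b).down ≠ (i, c) :=
            fun b hb hbi => hex ⟨b, hb, hbi⟩
          exact ⟨⟨.inr (⟨c, ⟨(⟨i⟩, v), hm⟩⟩, c), abuts_new.2 (by simp)⟩, rfl⟩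
      · by_cases hex : ∃ b : G.Branch, G.abuts b = some v ∧ (φ.branchMap b).down = (i, !c)
        · obtain ⟨b, hb, hbi⟩ := hex
          refine ⟨⟨.inl (.inr b), abuts_rev.2 ⟨v, hb, rfl⟩⟩, Subtype.ext (ULift.ext _ _ ?_)⟩
          change ((φ.branchMap b).down.1, !(φ.branchMap b).down.2) = (i, c)
          rw [hbi, Bool.not_not]
        · have hm : ∀ b : G.Branch, G.abuts b = some v → (φ.branchMap b).down ≠ (i, !c) :=
            fun b hb hbi => hex ⟨b, hb, hbi⟩
          refine ⟨⟨.inr (⟨!c, ⟨(⟨i⟩, v), hm⟩⟩, c), abuts_new.2 ?_⟩, rfl⟩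
          cases c <;> simp
  /- (6) `ι` is an embedding (injective on vertices and edges, out of a graph). -/
  have hemb : IsEmbedding ι := isEmbedding_of_injective_of_isGraph ι hGg
    (fun _ _ h => Sum.inl.inj h) (fun _ _ h => Sum.inl.inj (Sum.inl.inj h))
  /- (7) Assemble: `φ'` is a finite graph-covering by Lemma 1.3 (iii). -/
  exact ⟨G', ι, φ', hfin, hemb, ((lemma_1_3_iii'_holds _ _ φ' hfin hgraph (bouquet_isFinite n)
    (bouquet_isGraph n)).2).2 hexc, hcomp⟩

end SemiGraph

end Literature.AnabelianGeometry.SemiGraphs
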